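import Mathlib
import Summits.AtomisticToContinuum.FouriersLaw.Theorems.EmbeddedDrudeMourreKineticConductivityFiniteAlgebra
import HarnessLib

/-!
# Critical values of the pair resonance function — `stub_regularLevels` (stub RL)
# of line `swap-odd-threshold-rigidity`
(crux `EmbeddedDrudeMourre.MourreDissolution`, item stmt-AtomisticToContinuum-12594; helper file, `--supports`)

Registered stub RL of the checked skeleton of line `swap-odd-threshold-rigidity` (lead c8), in the
skeleton's stub namespace `Summit.AtomisticToContinuum.FouriersLaw.Theorems.MourreDissolution`.

For the pinned band `ω(k) = √(ω₂ + 2(1 − cos k))` (`PhononBoltzmann.dispersion`, `ω₂ > 0`), its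
group velocity `v(k) = sin k / ω(k)` (`groupVelocity`) and the resonance function
`Ω(k₁,k₂,k₃) = ω₁ + ω₂ − ω₃ − ω₄` (`resonanceFn`; `ωⱼ = ω(kⱼ)`, `k₄ = k₁ + k₂ − k₃`):
if the four group velocities coincide (`∇Ω = 0`), then `Ω = 0` or `|Ω| = 2(√(ω₂+4) − √ω₂)`
(`= 2(ω(π) − ω(0))`, attained at the corners `(0,0,π)`, `(π,π,0)` mod `2π`). Hence every level
`E` with `0 < |E| < 2(√(ω₂+4) − √ω₂)` is a regular value of `Ω` on the whole torus `𝕋³`.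

Proof. Write `u` for the common velocity, `cⱼ = cos kⱼ`, `sⱼ = sin kⱼ`; then `sⱼ = u ωⱼ`
(`regularLevels_sin_eq`) and `sⱼ² + cⱼ² = 1`, `ωⱼ² = (ω₂+2) − 2cⱼ` make every `cⱼ` a root of ONE
quadratic `c² − 2u²c + (u²(ω₂+2) − 1) = 0` (`regularLevels_cos_quadratic`), so the cosines take at
most two values, `cᵢ = cⱼ ∨ cⱼ = 2u² − cᵢ` (`regularLevels_cos_eq_or`); and `cᵢ = cⱼ` forces
`ωᵢ = ωⱼ`, `sᵢ = u ωᵢ = sⱼ`, i.e. `kᵢ ≡ kⱼ (mod 2π)` (`regularLevels_coe_eq`, in `Real.Angle`).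
If `{c₁,c₂} = {c₃,c₄}` as multisets then `Ω = 0`. Three congruent momenta and momentum conservation
`k₄ = k₁ + k₂ − k₃` make the fourth congruent too (`regularLevels_cos_transfer`), so "three equal
cosines, one different" is impossible. In the remaining pattern `c₁ = c₂ ≠ c₃ = c₄` one has
`k₁ ≡ k₂`, `k₃ ≡ k₄ = k₁ + k₂ − k₃`, so `2k₃ ≡ 2k₁`, `k₃ ≡ k₁ + π` (`Real.Angle.two_nsmul_eq_iff`),
`c₃ = −c₁`, `s₃ = −s₁`; with `sⱼ = u ωⱼ`, `ωⱼ > 0` this gives `u = 0`, `s₁ = 0`, `c₁ = ±1`,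
`c₃ = c₄ = ∓1`, `{ω₁, ω₃} = {√ω₂, √(ω₂+4)}` and `Ω = 2ω₁ − 2ω₃ = ±2(√(ω₂+4) − √ω₂)`.
Pure algebra/trigonometry; no cited facts.
-/

noncomputable section

namespace Summit.AtomisticToContinuum.FouriersLaw.Theorems.MourreDissolution

open Literature.MathematicalPhysics.KineticTheory
open Literature.MathematicalPhysics.KineticTheory.PhononBoltzmann

/-! ### The common velocity: `sin k = u ω(k)` and the quadratic for `cos k` -/

/-- `v(k) = u` means `sin k = u ω(k)` (`ω(k) > 0` for `ω₂ > 0`). [folklore] -/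
theorem regularLevels_sin_eq {ω₂ : ℝ} (hω : 0 < ω₂) {k u : ℝ} (h : groupVelocity ω₂ k = u) :
    Real.sin k = u * dispersion ω₂ k := by
  unfold groupVelocity at h
  rwa [div_eq_iff (dispersion_pos hω k).ne'] at h

/-- If `sin k = u ω(k)` then `cos k` is a root of the quadratic `c² − 2u²c + (u²(ω₂+2) − 1)`
(from `sin² + cos² = 1` and `ω² = (ω₂+2) − 2 cos k`). [folklore] -/
theorem regularLevels_cos_quadratic {ω₂ : ℝ} (hω : 0 < ω₂) {k u : ℝ}
    (h : Real.sin k = u * dispersion ω₂ k) :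
    Real.cos k ^ 2 - 2 * u ^ 2 * Real.cos k + (u ^ 2 * (ω₂ + 2) - 1) = 0 := by
  have h1 := Real.sin_sq_add_cos_sq k
  have h2 := KineticConductivityFinite.dispersion_sq' hω.le k
  have h3 : Real.sin k ^ 2 = u ^ 2 * dispersion ω₂ k ^ 2 := by rw [h]; ring
  linear_combination h1 - h3 - u ^ 2 * h2

/-- **The cosines take at most two values.** If `sin x = u ω(x)` and `sin y = u ω(y)` then
`cos x = cos y` or `cos y = 2u² − cos x` (two roots of one quadratic). [folklore] -/
theorem regularLevels_cos_eq_or {ω₂ : ℝ} (hω : 0 < ω₂) {x y u : ℝ}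
    (hx : Real.sin x = u * dispersion ω₂ x) (hy : Real.sin y = u * dispersion ω₂ y) :
    Real.cos x = Real.cos y ∨ Real.cos y = 2 * u ^ 2 - Real.cos x := by
  have qx := regularLevels_cos_quadratic hω hx
  have qy := regularLevels_cos_quadratic hω hy
  have h0 : (Real.cos x - Real.cos y) * (Real.cos x + Real.cos y - 2 * u ^ 2) = 0 := by
    linear_combination qx - qy
  rcases mul_eq_zero.1 h0 with h | h
  · exact Or.inl (sub_eq_zero.1 h)
  · exact Or.inr (by linarith)

/-- Equal cosines give equal band energies. [folklore] -/
theorem regularLevels_dispersion_eq {ω₂ x y : ℝ} (hc : Real.cos x = Real.cos y) :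
    dispersion ω₂ x = dispersion ω₂ y := by
  unfold dispersion
  rw [hc]

/-- **Equal cosines at a common velocity force congruence.** If `sin x = u ω(x)`, `sin y = u ω(y)`
and `cos x = cos y` then `ω(x) = ω(y)`, `sin x = sin y`, so `x ≡ y (mod 2π)`. [folklore] -/
theorem regularLevels_coe_eq {ω₂ x y u : ℝ}
    (hx : Real.sin x = u * dispersion ω₂ x) (hy : Real.sin y = u * dispersion ω₂ y)
    (hc : Real.cos x = Real.cos y) : (x : Real.Angle) = y := by
  have hs : Real.sin x = Real.sin y := by rw [hx, hy, regularLevels_dispersion_eq hc]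
  exact Real.Angle.cos_sin_inj hc hs

/-- Momentum transfer: if `y ≡ z (mod 2π)` then `cos (x + y − z) = cos x`. [folklore] -/
theorem regularLevels_cos_transfer {x y z : ℝ} (h : (y : Real.Angle) = z) :
    Real.cos (x + y - z) = Real.cos x := by
  rw [← Real.Angle.cos_coe, Real.Angle.coe_sub, Real.Angle.coe_add, h, add_sub_cancel_right,
    Real.Angle.cos_coe]

/-! ### The corner values -/

/-- `ω = √ω₂` where `cos k = 1` and `ω = √(ω₂+4)` where `cos k = −1`. [folklore] -/
theorem regularLevels_dispersion_corner (ω₂ k : ℝ) :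
    (Real.cos k = 1 → dispersion ω₂ k = Real.sqrt ω₂) ∧
      (Real.cos k = -1 → dispersion ω₂ k = Real.sqrt (ω₂ + 4)) := by
  constructor
  · intro h
    unfold dispersion
    rw [h]
    norm_num
  · intro h
    unfold dispersion
    rw [h]
    norm_num

/-! ### The statement -/

/-- **Stub RL of line `swap-odd-threshold-rigidity` (`stub_regularLevels`): the only critical values
of the pair resonance function are `0` and `±2(ω(π) − ω(0))`.** For `ω₂ > 0` and real `k₁, k₂, k₃`
(`k₄ = k₁ + k₂ − k₃`): if `v(k₁) = v(k₂) = v(k₃) = v(k₄)` (`v = groupVelocity ω₂ = ω'`, i.e.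
`∇Ω = 0`) then `Ω(k₁,k₂,k₃) = 0` or `|Ω(k₁,k₂,k₃)| = 2(√(ω₂+4) − √ω₂)`. In particular every `E`
with `0 < |E| < 2(√(ω₂+4) − √ω₂)` is a regular value of `Ω = resonanceFn ω₂` on all of `𝕋³`.
[folklore] -/
theorem stub_regularLevels :
    ∀ ω₂ : ℝ, 0 < ω₂ → ∀ k₁ k₂ k₃ : ℝ,
      groupVelocity ω₂ k₁ = groupVelocity ω₂ k₂ →
      groupVelocity ω₂ k₂ = groupVelocity ω₂ k₃ →
      groupVelocity ω₂ k₃ = groupVelocity ω₂ (k₁ + k₂ - k₃) →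
      resonanceFn ω₂ k₁ k₂ k₃ = 0 ∨
        |resonanceFn ω₂ k₁ k₂ k₃| = 2 * (Real.sqrt (ω₂ + 4) - Real.sqrt ω₂) := by
  intro ω₂ hω k₁ k₂ k₃ h12 h23 h34
  generalize hu : groupVelocity ω₂ (k₁ + k₂ - k₃) = u at h34
  rw [h34] at h23
  rw [h23] at h12
  have s1 := regularLevels_sin_eq hω h12
  have s2 := regularLevels_sin_eq hω h23
  have s3 := regularLevels_sin_eq hω h34
  have s4 := regularLevels_sin_eq hω hu
  unfold resonanceFn
  by_cases h13 : Real.cos k₁ = Real.cos k₃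
  · by_cases h24 : Real.cos k₂ = Real.cos (k₁ + k₂ - k₃)
    · -- pattern `{c₁,c₂} = {c₃,c₄}`: `ω₁ = ω₃`, `ω₂ = ω₄`
      left
      rw [regularLevels_dispersion_eq h13, regularLevels_dispersion_eq h24]
      ring
    · exfalso
      have h24' := (regularLevels_cos_eq_or hω s2 s4).resolve_left h24
      by_cases h12c : Real.cos k₁ = Real.cos k₂
      · -- `k₁ ≡ k₂ ≡ k₃`, hence `k₄ ≡ k₁`: contradicts `c₂ ≠ c₄`
        have e23 : (k₂ : Real.Angle) = k₃ := regularLevels_coe_eq s2 s3 (h12c.symm.trans h13)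
        have := regularLevels_cos_transfer (x := k₁) e23
        exact h24 (by rw [this, h12c])
      · -- `c₂ = 2u² − c₁`, so `c₄ = c₁ = c₃`: `k₁ ≡ k₃ ≡ k₄`, hence `k₂ ≡ k₁`
        have h12' := (regularLevels_cos_eq_or hω s1 s2).resolve_left h12c
        have e13 : (k₁ : Real.Angle) = k₃ := regularLevels_coe_eq s1 s3 h13
        have := regularLevels_cos_transfer (x := k₂) e13
        rw [show k₂ + k₁ - k₃ = k₁ + k₂ - k₃ by ring, h24', h12'] at this
        exact h12c (by linarith)
  · have h13' := (regularLevels_cos_eq_or hω s1 s3).resolve_left h13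
    by_cases h14 : Real.cos k₁ = Real.cos (k₁ + k₂ - k₃)
    · by_cases h23c : Real.cos k₂ = Real.cos k₃
      · -- pattern `{c₁,c₂} = {c₄,c₃}`: `ω₁ = ω₄`, `ω₂ = ω₃`
        left
        rw [regularLevels_dispersion_eq h14, regularLevels_dispersion_eq h23c]
        ring
      · -- `c₃ = 2u² − c₂ = 2u² − c₁`, so `c₁ = c₂ = c₄`: `k₁ ≡ k₂ ≡ k₄`, hence `k₃ ≡ k₁`
        exfalso
        have h23' := (regularLevels_cos_eq_or hω s2 s3).resolve_left h23c
        have h12c : Real.cos k₁ = Real.cos k₂ := by linarith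
        have e24 : (k₂ : Real.Angle) = (k₁ + k₂ - k₃ : ℝ) :=
          regularLevels_coe_eq s2 s4 (h12c.symm.trans h14)
        have := regularLevels_cos_transfer (x := k₁) e24
        rw [show k₁ + k₂ - (k₁ + k₂ - k₃) = k₃ by ring] at this
        exact h13 this.symm
    · have h14' := (regularLevels_cos_eq_or hω s1 s4).resolve_left h14
      have h34c : Real.cos k₃ = Real.cos (k₁ + k₂ - k₃) := by rw [h13', h14']
      by_cases h12c : Real.cos k₁ = Real.cos k₂
      · -- the pattern `c₁ = c₂ ≠ c₃ = c₄`: `k₁ ≡ k₂`, `k₃ ≡ k₄`, so `2k₃ ≡ 2k₁`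
        have e12 : (k₁ : Real.Angle) = k₂ := regularLevels_coe_eq s1 s2 h12c
        have e34 : (k₃ : Real.Angle) = (k₁ + k₂ - k₃ : ℝ) := regularLevels_coe_eq s3 s4 h34c
        rw [Real.Angle.coe_sub, Real.Angle.coe_add, ← e12] at e34
        have h2 : (2 : ℕ) • (k₃ : Real.Angle) = (2 : ℕ) • (k₁ : Real.Angle) := by
          rw [two_nsmul, two_nsmul]
          nth_rw 1 [e34]
          abel
        rcases Real.Angle.two_nsmul_eq_iff.1 h2 with h | h
        · -- `k₃ ≡ k₁` contradicts `c₁ ≠ c₃`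
          exfalso
          have hc := Real.Angle.cos_coe k₃
          rw [h, Real.Angle.cos_coe] at hc
          exact h13 hc
        · -- `k₃ ≡ k₁ + π`: `c₃ = −c₁`, `s₃ = −s₁`, so `u = 0`, `s₁ = 0`, `c₁ = ±1`
          have hc3 := Real.Angle.cos_coe k₃
          rw [h, Real.Angle.cos_add_pi, Real.Angle.cos_coe] at hc3
          have hs3 := Real.Angle.sin_coe k₃
          rw [h, Real.Angle.sin_add_pi, Real.Angle.sin_coe] at hs3
          -- `hc3 : -cos k₁ = cos k₃`, `hs3 : -sin k₁ = sin k₃`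
          have hu0 : u = 0 := by
            have hpos : 0 < dispersion ω₂ k₁ + dispersion ω₂ k₃ :=
              add_pos (dispersion_pos hω k₁) (dispersion_pos hω k₃)
            have h0 : u * (dispersion ω₂ k₁ + dispersion ω₂ k₃) = 0 := by
              linear_combination -s1 - s3 - hs3
            rcases mul_eq_zero.1 h0 with h' | h'
            · exact h'
            · exact absurd h' hpos.ne'
          have hs1 : Real.sin k₁ = 0 := by rw [s1, hu0, zero_mul]
          have hc4 : Real.cos (k₁ + k₂ - k₃) = -Real.cos k₁ := by rw [← h34c, ← hc3]
          have hc2 : Real.cos k₂ = Real.cos k₁ := h12c.symm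
          right
          have hlt : Real.sqrt ω₂ < Real.sqrt (ω₂ + 4) := Real.sqrt_lt_sqrt hω.le (by linarith)
          rcases Real.sin_eq_zero_iff_cos_eq.1 hs1 with h1 | h1
          · -- the corner `(0, 0, π)`: `Ω = 2√ω₂ − 2√(ω₂+4) < 0`
            have d1 := (regularLevels_dispersion_corner ω₂ k₁).1 h1
            have d2 := (regularLevels_dispersion_corner ω₂ k₂).1 (by rw [hc2, h1])
            have d3 := (regularLevels_dispersion_corner ω₂ k₃).2 (by rw [← hc3, h1])
            have d4 := (regularLevels_dispersion_corner ω₂ (k₁ + k₂ - k₃)).2 (by rw [hc4, h1])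
            rw [d1, d2, d3, d4, abs_of_nonpos (by linarith)]
            ring
          · -- the corner `(π, π, 0)`: `Ω = 2√(ω₂+4) − 2√ω₂ > 0`
            have d1 := (regularLevels_dispersion_corner ω₂ k₁).2 h1
            have d2 := (regularLevels_dispersion_corner ω₂ k₂).2 (by rw [hc2, h1])
            have d3 := (regularLevels_dispersion_corner ω₂ k₃).1 (by rw [← hc3, h1]; ring)
            have d4 := (regularLevels_dispersion_corner ω₂ (k₁ + k₂ - k₃)).1 (by rw [hc4, h1]; ring)
            rw [d1, d2, d3, d4, abs_of_nonneg (by linarith)]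
            ring
      · -- `c₂ = 2u² − c₁ = c₃ = c₄`: `k₂ ≡ k₃ ≡ k₄`, hence `k₁ ≡ k₄ ≡ k₂`
        exfalso
        have h12' := (regularLevels_cos_eq_or hω s1 s2).resolve_left h12c
        have e23 : (k₂ : Real.Angle) = k₃ := regularLevels_coe_eq s2 s3 (by rw [h12', h13'])
        have := regularLevels_cos_transfer (x := k₁) e23
        rw [h14'] at this
        exact h12c (by linarith)

end Summit.AtomisticToContinuum.FouriersLaw.Theorems.MourreDissolution

end
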